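import Mathlib.Algebra.MvPolynomial.PDeriv
import Mathlib.LinearAlgebra.Matrix.Determinant.Basic
import Mathlib.ModelTheory.Algebra.Ring.Basic
import Literature.ModelTheory.PseudofiniteFields.FiniteFieldTheory
import Literature.ModelTheory.PseudofiniteFields.EtaleOpenTopology
import HarnessLib

/-!
# `PairwiseCurvedTilingsLC` (crux stmt-MatrixMultiplication-17883), line LonelyTranslates:
no lonely interior point of the `A − C` shadow

The étale-open-topology step of the (conditional) refutation of the crux.  Everything here is
pure combinatorics of the étale-open topology on `K^m` as rendered in
`Literature.ModelTheory.PseudofiniteFields.EtaleOpenTopology` (`EtaleDatum.image`,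
`IsEtaleOpenIn`, `IsEtaleIsolatedIn`, `SmoothDatum.locus`); the two published facts the line
consumes — non-isolation of points of positive-dimensional standard smooth loci
(Johnson–Tran–Walsberg–Ye 2024, Thm 7.1) and the decomposition of definable sets into points and
étale-open pieces of standard smooth loci (Walsberg–Ye 2023, Thm C/D) — enter ONLY as the
hypotheses `hiso`, `hU`, `hB` of `stub_noLonelyInterior`, and the basis properties of standard
étale images (principal opens, translates, intersections) enter as the hypothesis `hbasis`.

The argument.  Pattern `i = j` of the pairwise STPP clause makes every translate `B_x + (P − t)`
(`t ∈ B_x`) of a block through a shadow point `P = a − u` (`a ∈ A_x`, `u ∈ C_x`) LONELY: it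
meets the shadow `U = A − C` only at `P`.  If `P` were an étale-interior point of `U`, translating
an étale neighbourhood `O ⊆ U` of `P` back by `P − t` would give an étale neighbourhood of `t`
meeting `B_x` only in `t`; when `B_x` is infinite, some piece of its decomposition is an
étale-open subset of a positive-dimensional standard smooth locus, and a point `t` of that piece
would then be étale-isolated in the locus — impossible.  So no shadow point over an infinite
block is étale-interior in `U`, and the non-interior points of `U` lie on the hypersurface
`D = 0`, `D ≠ 0` the product over the pieces of `U` of: a linear form through the point (point
pieces), the first equation `g_0` (pieces of positive codimension), `1` (open pieces).

* `noLonely_exists_vanishing_or_interior` — the per-piece polynomial;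
* `noLonely_exists_open_piece` — an infinite decomposed set has a nonempty étale-open piece of a
  positive-dimensional locus;
* `stub_noLonelyInterior` — the statement consumed by the lead's composition
  (`porosityShadowBound_of_facts`).
-/

set_option linter.dupNamespace false  -- `Summit.<S>.<S>.…` is the mandated namespace

namespace Summit.MatrixMultiplication.MatrixMultiplication.Theorems.PairwiseCurvedTilingsLC.Negative

open Literature.ModelTheory.PseudofiniteFields

/-- Per-piece polynomial.  For a piece `X` of a Walsberg–Ye decomposition in `K^m`, `0 < m`
(a point, or an étale-open subset of a standard smooth locus of codimension `c < m`) there is a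
NON-ZERO polynomial `D` such that every point `P ∈ X` with `D(P) ≠ 0` is an étale-interior point
of `X` in `K^m`: `D` is a linear form through the point if `X` is a point, the first equation
`g_0` of the locus if `0 < c` (non-zero because the Jacobian minor does not vanish on `X ≠ ∅`),
and `1` if `c = 0`, where the locus `{h ≠ 0, Δ ≠ 0}` is itself a basic étale-open set, so that
(intersecting) `X` is étale-open in `K^m`.  The basis properties used — principal opens are étale
images (`hne`) and étale images are stable under pairwise intersection (`hint`) — are
hypotheses. -/
theorem noLonely_exists_vanishing_or_interior {K : Type} [Field K] {m : ℕ} (hm : 0 < m)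
    (hne : ∀ f : MvPolynomial (Fin m) K, ∃ D : EtaleDatum K m 1,
      D.image = {x | MvPolynomial.eval x f ≠ 0})
    (hint : ∀ (r₁ r₂ : ℕ) (D₁ : EtaleDatum K m r₁) (D₂ : EtaleDatum K m r₂),
      ∃ D : EtaleDatum K m (r₁ + r₂), D.image = D₁.image ∩ D₂.image)
    {c : ℕ} (S : SmoothDatum K m c) (X : Set (Fin m → K))
    (hX : X.Subsingleton ∨ (c < m ∧ IsEtaleOpenIn K S.locus X)) :
    ∃ D : MvPolynomial (Fin m) K, D ≠ 0 ∧ ∀ P ∈ X, MvPolynomial.eval P D ≠ 0 →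
      ∃ (r : ℕ) (O : EtaleDatum K m r), P ∈ O.image ∧ O.image ⊆ X := by
  classical
  by_cases hsub : X.Subsingleton
  · rcases hsub.eq_empty_or_singleton with rfl | ⟨p, rfl⟩
    · exact ⟨1, one_ne_zero, fun P hP => hP.elim⟩
    · refine ⟨MvPolynomial.X ⟨0, hm⟩ - MvPolynomial.C (p ⟨0, hm⟩), fun h => ?_, fun P hP hPD => ?_⟩
      · have h1 := congr_arg (MvPolynomial.eval fun _ => p ⟨0, hm⟩ + 1) h
        simp at h1
      · rw [Set.mem_singleton_iff] at hP
        subst hP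
        simp at hPD
  · obtain ⟨-, hXloc, hnb⟩ := hX.resolve_left hsub
    rcases Nat.eq_zero_or_pos c with hc | hc
    · subst hc
      refine ⟨1, one_ne_zero, fun P hP _ => ?_⟩
      obtain ⟨r, E, hPE, hEX⟩ := hnb P hP
      obtain ⟨E₀, hE₀⟩ := hne (S.h * S.minor)
      obtain ⟨O, hO⟩ := hint r 1 E E₀
      have hloc : S.locus = E₀.image := by
        rw [hE₀]
        ext z
        simp [SmoothDatum.mem_locus_iff]
      refine ⟨r + 1, O, ?_, ?_⟩
      · rw [hO]
        exact ⟨hPE, hloc ▸ hXloc hP⟩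
      · rw [hO, ← hloc]
        exact hEX
    · refine ⟨S.g ⟨0, hc⟩, fun hg => ?_, fun P hP hPD => absurd ((hXloc hP).1 ⟨0, hc⟩) hPD⟩
      obtain ⟨p, hp⟩ := (Set.not_subsingleton_iff.1 hsub).nonempty
      have hmin : S.minor = 0 := by
        unfold SmoothDatum.minor
        exact Matrix.det_eq_zero_of_row_eq_zero ⟨0, hc⟩ fun j => by simp [hg]
      exact (hXloc hp).2.2 (by rw [hmin, map_zero])

/-- An infinite set decomposed à la Walsberg–Ye into finitely many pieces, each a point or an
étale-open subset of a standard smooth locus of codimension `< m`, has an infinite — hence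
nonempty, non-point — piece, which is therefore étale-open in a positive-dimensional locus. -/
theorem noLonely_exists_open_piece {K : Type} [Field K] {m n : ℕ} {c : Fin n → ℕ}
    (S : ∀ i, SmoothDatum K m (c i)) (X : Fin n → Set (Fin m → K))
    (hX : ∀ i, (X i).Subsingleton ∨ (c i < m ∧ IsEtaleOpenIn K (S i).locus (X i)))
    (hinf : (⋃ i, X i).Infinite) :
    ∃ i, c i < m ∧ IsEtaleOpenIn K (S i).locus (X i) ∧ (X i).Nonempty := by
  obtain ⟨i, hi⟩ : ∃ i, (X i).Infinite := by
    by_contra h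
    exact hinf (Set.finite_iUnion fun i => Set.not_infinite.1 (not_exists.1 h i))
  obtain ⟨hci, hopen⟩ := (hX i).resolve_left fun hs => hi hs.finite
  exact ⟨i, hci, hopen, hi.nonempty⟩

/-- **No lonely interior point** (line LonelyTranslates, stub G).  In a field `K` where no point
of a standard smooth locus of codimension `< m` in `K^m` is étale-isolated (`hiso`) and standard
étale images contain the principal opens and are stable under translation and pairwise
intersection (`hbasis`): if a family `(A_x, B_x, C_x)_{x ∈ I}` of subsets of `K^m` satisfies the
pattern `i = j` of the pairwise STPP clause (`hpat`), and the `A − C` shadow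
`U = {a − u | x ∈ I, a ∈ A_x, u ∈ C_x}` (`hU`) and every block `B_x` (`hB`) decompose into
finitely many pieces, each a point or an étale-open subset of a standard smooth locus of
codimension `< m`, then there is a NON-ZERO polynomial `D` vanishing at every shadow point
`a − u` over a block `x` with `B_x` infinite.  Proof: a shadow point `P` with `D(P) ≠ 0` is
étale-interior in `U` (`noLonely_exists_vanishing_or_interior`); an infinite `B_x` has a point `t`
in an étale-open piece of a positive-dimensional locus (`noLonely_exists_open_piece`); translating
the neighbourhood of `P` by `t − P` and using pattern `i = j` (the translate `B_x + (P − t)` meets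
`U` only at `P`) makes `t` étale-isolated in that locus, contradicting `hiso`. -/
theorem stub_noLonelyInterior {K : Type} [Field K] {e m : ℕ}
    (hiso : ∀ c : ℕ, c < m → ∀ (S : SmoothDatum K m c) (p : Fin m → K),
      ¬ IsEtaleIsolatedIn K S.locus p)
    (hbasis : (∀ f : MvPolynomial (Fin m) K, ∃ D : EtaleDatum K m 1,
        D.image = {x | MvPolynomial.eval x f ≠ 0}) ∧
      (∀ (r : ℕ) (D : EtaleDatum K m r) (v : Fin m → K), ∃ D' : EtaleDatum K m r,
        D'.image = {x | x + v ∈ D.image}) ∧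
      (∀ (r₁ r₂ : ℕ) (D₁ : EtaleDatum K m r₁) (D₂ : EtaleDatum K m r₂),
        ∃ D : EtaleDatum K m (r₁ + r₂), D.image = D₁.image ∩ D₂.image))
    (I : Set (Fin e → K)) (A B C : (Fin e → K) → Set (Fin m → K))
    (hpat : ∀ i ∈ I, ∀ k ∈ I, ∀ s ∈ A k, ∀ s' ∈ A i, ∀ t ∈ B i, ∀ t' ∈ B i, ∀ u ∈ C i,
      ∀ u' ∈ C k, (s' - s) + (t' - t) + (u' - u) = 0 → i = k ∧ s = s' ∧ t = t' ∧ u = u')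
    (hU : ∃ (n : ℕ) (c : Fin n → ℕ) (S : ∀ i, SmoothDatum K m (c i)) (X : Fin n → Set (Fin m → K)),
      {w | ∃ x ∈ I, ∃ a ∈ A x, ∃ u ∈ C x, w = a - u} = (⋃ i, X i) ∧
        ∀ i, (X i).Subsingleton ∨ (c i < m ∧ IsEtaleOpenIn K (S i).locus (X i)))
    (hB : ∀ x ∈ I, ∃ (n : ℕ) (c : Fin n → ℕ) (S : ∀ i, SmoothDatum K m (c i))
      (X : Fin n → Set (Fin m → K)),
      B x = (⋃ i, X i) ∧ ∀ i, (X i).Subsingleton ∨ (c i < m ∧ IsEtaleOpenIn K (S i).locus (X i))) :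
    ∃ D : MvPolynomial (Fin m) K, D ≠ 0 ∧
      ∀ x ∈ I, (B x).Infinite → ∀ a ∈ A x, ∀ u ∈ C x, MvPolynomial.eval (a - u) D = 0 := by
  classical
  obtain ⟨hne, htr, hint⟩ := hbasis
  rcases Nat.eq_zero_or_pos m with hm | hm
  · -- `m = 0`: `K^0` is one point, no block is infinite, and `D = 1` does it vacuously.
    subst hm
    exact ⟨1, one_ne_zero, fun x _ hBinf => absurd (Set.toFinite (B x)) hBinf⟩
  -- the per-piece polynomials of the shadow decomposition and their product
  obtain ⟨n, c, S, X, hUX, hX⟩ := hU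
  choose Dp hDp0 hDp using fun i =>
    noLonely_exists_vanishing_or_interior hm hne hint (S i) (X i) (hX i)
  refine ⟨∏ i, Dp i, Finset.prod_ne_zero_iff.2 fun i _ => hDp0 i, ?_⟩
  intro x hx hBinf a ha u hu
  by_contra hPD
  -- (1) the shadow point `P = a - u` is étale-interior in the shadow: `P ∈ O.image ⊆ X i ⊆ U`
  rw [map_prod] at hPD
  have hPU : a - u ∈ ⋃ i, X i := by
    rw [← hUX]
    exact ⟨x, hx, a, ha, u, hu, rfl⟩
  obtain ⟨i, hPi⟩ := Set.mem_iUnion.1 hPU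
  obtain ⟨r, O, hPO, hOX⟩ :=
    hDp i (a - u) hPi (Finset.prod_ne_zero_iff.1 hPD i (Finset.mem_univ i))
  -- (2) an infinite block has a point `t` in an étale-open piece of a positive-dimensional locus
  obtain ⟨n', c', S', X', hBX, hX'⟩ := hB x hx
  obtain ⟨j, hcj, ⟨hXlocus, hnbhd⟩, t, ht⟩ :=
    noLonely_exists_open_piece S' X' hX' (by rwa [← hBX])
  have hXB : X' j ⊆ B x := fun z hz => by
    rw [hBX]
    exact Set.mem_iUnion.2 ⟨j, hz⟩
  obtain ⟨r'', E'', htE, hEX⟩ := hnbhd t ht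
  -- (3) translate the neighbourhood `O` of `P` to `t` and cut it down by `E''`
  obtain ⟨O', hO'⟩ := htr r O (a - u - t)
  obtain ⟨Nb, hNb⟩ := hint r r'' O' E''
  have htO' : t ∈ O'.image := by
    rw [hO', Set.mem_setOf_eq, add_sub_cancel]
    exact hPO
  -- (4) loneliness: pattern `i = j` forces `Nb.image ∩ locus ⊆ {t}`
  have hlone : Nb.image ∩ (S' j).locus ⊆ {t} := by
    rintro z ⟨hzN, hzloc⟩
    rw [hNb] at hzN
    obtain ⟨hzO', hzE⟩ := hzN
    have hzB : z ∈ B x := hXB (hEX ⟨hzE, hzloc⟩)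
    rw [hO'] at hzO'
    have hwU : z + (a - u - t) ∈ ⋃ i, X i := Set.mem_iUnion.2 ⟨i, hOX hzO'⟩
    rw [← hUX] at hwU
    obtain ⟨x', hx', a', ha', u', hu', hw⟩ := hwU
    have key := hpat x hx x' hx' a' ha' a ha t (hXB ht) z hzB u hu u' hu' (by
      have hre : (a - a') + (z - t) + (u' - u) = (z + (a - u - t)) - (a' - u') := by abel
      rw [hre, hw, sub_self])
    exact Set.mem_singleton_iff.2 key.2.2.1.symm
  -- (5) so `t` is étale-isolated in the positive-dimensional locus `(S' j).locus`: impossible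
  refine hiso (c' j) hcj (S' j) t ⟨hXlocus ht, _, Nb, ?_, hlone⟩
  rw [hNb]
  exact ⟨htO', htE⟩

end Summit.MatrixMultiplication.MatrixMultiplication.Theorems.PairwiseCurvedTilingsLC.Negative
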